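import Mathlib
import Literature.Geometry.Lorentzian.IPlusRegular
import Literature.Geometry.Lorentzian.Einstein
import HarnessLib

/-!
# Alexakis–Ionescu–Klainerman 2010, Thm. 1.2: the rotational Killing field near a non-degenerate
horizon carrying a Hawking field (named fact, D-0014; topic `Literature/Geometry/Lorentzian`)

S. Alexakis, A. D. Ionescu, S. Klainerman, *Hawking's local rigidity theorem without analyticity*,
Geom. Funct. Anal. **20** (2010) 845–869 = arXiv:0902.1173.  **Theorem 1.2** (printed): "Assume that
`(S, 𝓝, 𝓝̲)` is a local, regular, bifurcate, horizon in a vacuum Einstein space-time `(O, g)` which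
possesses a Killing vectorfield `T` tangent to `𝓝 ∪ 𝓝̲` and non-vanishing on `S`. Then, there
exists an open neighborhood `O' ⊆ O` of `S` and a non-trivial rotational Killing vector-field `Z`
in `O'` which commutes with `T`."  The proof (§5) gives the quantitative form, **Proposition 5.2**:
"There is a constant `λ₀ ∈ ℝ` and an open neighborhood `O' ⊆ O` of `S` such that the vector-field
`Z = T + λ₀ K` has periodic orbits in `O'`. In other words, there is `t₀ > 0` such that
`Ψ_{t₀,Z} = Id` in `O'`" (`K` the Hawking Killing field of Thm. 1.1, tangent to the null generators
of `𝓝` and `𝓝̲`, `[T, K] = 0`, Prop. 5.1), together with the footnote to **Lemma 5.3**: "If `T ≡ 0`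
on `S` [i.e. `T` is tangent to the generators] then any value of `t₀ > 0` is suitable. In this case,
the conclusion of Proposition 5.2 is that `T + λ₀ K ≡ 0` in `O'` for some `λ₀ ∈ ℝ`."  So the
printed dichotomy is: near the horizon EITHER `T` is a constant multiple of the Hawking field, OR
some constant-coefficient combination `Z = T + λ₀ K` (`λ₀ ≠ 0`) generates a circle action by
isometries commuting with `T` ("the main constants `λ₀` and `t₀` can be determined on the
bifurcation sphere `S`", §1).

THE SETTING OF THIS FILE is the future event horizon `𝓔⁺` of a vacuum, `I⁺`-regular, stationary
asymptotically flat black hole WITHOUT white hole (`M = I⁺(M_ext)`), carrying a GIVEN Hawking field: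
a vector field `K`, `C^∞` and Killing on an open `U ⊇ 𝓔⁺`, commuting with the stationary field
`T = 𝓑.killing` there, nowhere zero on and tangent to `𝓔⁺`, timelike on `U ∩ ⟨⟨M_ext⟩⟩` (hence
null on `𝓔⁺` and tangent to its generators), with constant NON-ZERO surface gravity
`∇_K K = κ K` on `𝓔⁺`, `κ ≠ 0` (the non-degeneracy clause of `LorentzianMetric.IsNonDegenerateHorizon`
for this `K`).  The passage from the printed bifurcate setting to this one is classical and is
where the extra hypotheses are consumed: (a) `𝓔⁺` is a smooth null hypersurface with compact
cross-sections transverse to its generators and to `T` — P. T. Chruściel, J. L. Costa, Astérisque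
321 (2008) = arXiv:0806.0016, **Thm. 4.11** ("`⋃ₜ φₜ[K₀](S) ⊂ 𝓗₀` is a smooth null hypersurface")
with Props. 4.1–4.3 (compact cross-sections `S₁ = İ⁺(q) ∩ 𝓔₀`, smooth when `𝓔₀` is), for
`I⁺`-regular space-times satisfying the null energy condition; in space-time dimension four the
sections are spheres (ibid. Cor. 2.5 = Chruściel–Wald 1994); (b) a stationary black hole with no
white hole whose event horizon is a Killing horizon with compact cross-sections and constant
non-zero surface gravity "can be extended globally so that in the enlarged spacetime the image of
`𝓝` will be a proper subset of a bifurcate Killing horizon. Furthermore, an extension can be chosen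
so that the original one-parameter group of isometries `χ_u` extends" — I. Rácz, R. M. Wald, Class.
Quantum Grav. 13 (1996) 539–552, **Thm. 4.2** (no field equations used); the stationary isometries
`φₜ[T]` extend likewise (ibid. §4, Prop. 4.3), so that in the extension `T` is a Killing field tangent
to `𝓝 ∪ 𝓝̲`, non-vanishing on `S` (`T ≠ 0` on the horizon: Friedrich–Rácz–Wald 1999, Lemma 2.1);
(c) Thm. 1.2 / Prop. 5.2 in the extension give `Z = T + λ₀ K` with `Ψ_{t₀,Z} = Id` on a
neighbourhood `O'` of `S`, or `T + λ₀K ≡ 0` there; both alternatives are transported along the whole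
of `𝓔⁺` by the stationary isometries (which commute with `Z`), and restricted to the original
space-time, whose three `Z`-invariant pieces near the horizon (exterior wedge `⟨⟨M_ext⟩⟩`, `𝓔⁺ ∖ S`,
black-hole wedge) are unions of `Z`-orbits, `Z` being tangent to `𝓝 ∪ 𝓝̲`.  In the rotating
alternative `λ₀ ≠ 0` (else `T` itself would have closed orbits through `⟨⟨M_ext⟩⟩`, where it is
strongly causal — Friedrich–Rácz–Wald 1999, Lemma 2.1 and Chruściel–Costa 2008, Cor. 3.3), so that,
after rescaling `Z` to period `2π`, `K = α T + β Z` with `β = 2π/(t₀λ₀) ≠ 0`, `α = -1/λ₀`.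
The same near-horizon dichotomy is the classical first step of Hawking's rigidity theorem
(Hawking–Ellis 1973, Prop. 9.3.6; its gap-free form: Friedrich–Rácz–Wald 1999, **Prop. 2.1** —
"there exists a `t₀ ≠ 0` such that `φ_{t₀}` maps each null geodesic generator of `𝓝` into itself" —
and, for analytic horizons, Chruściel–Costa 2008, Thm. 4.13 / Rem. 4.15).

WHAT IS VENDORED (weaker than print, clause by clause).  Hypotheses: `𝓑 : StationaryAFBlackHole`
vacuum (`IsRicciFlat`), `I⁺`-regular (Chruściel–Costa Def. 1.1: `IsIPlusRegular`), future-presented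
(`∀ p, p ∈ I⁺(M_ext)`: no white hole, as in Rácz–Wald), `𝓔⁺` connected (one horizon component),
and the Hawking field `K` on `U` as above INCLUDING its non-degeneracy `∃ κ ≠ 0, ∇_K K = κ K` on `𝓔⁺`
(the printed theorems need a bifurcate, i.e. non-degenerate, horizon; the GIVEN `K` replaces the
output of AIK Thm. 1.1).  Conclusion: EITHER (non-rotating) `K = α T` on the trace `U'' ∩ ⟨⟨M_ext⟩⟩`
of an open `U'' ⊇ 𝓔⁺`; OR (rotating) there are an open `V` with `𝓔⁺ ⊆ V ⊆ U`, invariant under the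
flow of `T`, constants `α`, `β ≠ 0`, a vector field `Z` — `C^∞`, Killing and `T`-commuting on `V`,
with `K = α T + β Z` on `V` — and a COMPLETE `2π`-PERIODIC FLOW `Φ` of `Z` on `V` (`Φ 0 = id`,
`Φ s (V) ⊆ V`, `Φ (s + 2π) = Φ s`, `s ↦ Φ s x` an integral curve of `Z`) preserving `V ∩ ⟨⟨M_ext⟩⟩`.
Not vendored: the values of `λ₀, t₀` on `S`, the bifurcate extension itself, anything off `V`.
-- TODO(general form): the printed local statement for an abstract local, regular, bifurcate
-- horizon `(S, 𝓝, 𝓝̲)` in a vacuum `(O, g)` (needs bifurcate null hypersurfaces in the tree), the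
-- degenerate case, and higher dimensions (Hollands–Ishibashi–Wald: `N ≥ 1` commuting axial fields).

Used by the crux `NonTrappingHawkingRigidity` of the summit `FinalStateConjecture` (line
`azimuthal-partial-analyticity`, stub `stub_farAxialSeed`: the near-horizon end of the far axial
seed).  Vocabulary: `IPlusRegular.lean` (`IsIPlusRegular`, `𝓑.doc`, `𝓑.horizon`, `𝓑.Mext`),
`Stationary.lean` (`𝓑.killing`, `IsNonDegenerateHorizon` for the shape of the `κ`-clause), the
Killing equation `g(∇_v K, w) + g(v, ∇_w K) = 0` (O'Neill 1983, Ch. 9, Prop. 9.25) and the bracket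
`VectorField.mlieBracket` exactly as in the crux's binders.

## References
* S. Alexakis, A. D. Ionescu, S. Klainerman, Geom. Funct. Anal. 20 (2010) 845–869, arXiv:0902.1173,
  Thm. 1.2, Prop. 5.1, Prop. 5.2, Lemma 5.3 (and its footnote). [AlexakisIonescuKlainerman2010]
* I. Rácz, R. M. Wald, Class. Quantum Grav. 13 (1996) 539–552, gr-qc/9507055, Thm. 4.2, Prop. 4.3. [RaczWald1996]
* P. T. Chruściel, J. L. Costa, Astérisque 321 (2008) 195–265, arXiv:0806.0016, Props. 4.1–4.3,
  Thm. 4.11, Thm. 4.13, Rem. 4.15, Cor. 2.5, Cor. 3.3. [ChruscielCosta2008]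
* H. Friedrich, I. Rácz, R. M. Wald, Commun. Math. Phys. 204 (1999) 691–707, gr-qc/9811021,
  Lemma 2.1, Prop. 2.1. [FriedrichRaczWald1999]
* S. W. Hawking, G. F. R. Ellis, *The large scale structure of space-time*, CUP 1973, Prop. 9.3.6. [HawkingEllis1973]
-/

noncomputable section

open Bundle Set
open scoped Manifold ContDiff Topology

namespace Literature.Geometry.Lorentzian

/-- **Alexakis–Ionescu–Klainerman 2010, Thm. 1.2 with Prop. 5.2 (near-horizon rotational Killing
field), on the future event horizon of a vacuum `I⁺`-regular black hole without white hole, via the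
Rácz–Wald bifurcate extension of a non-degenerate horizon.**  For `𝓑` vacuum, `I⁺`-regular,
future-presented, with connected `𝓔⁺`, and a Hawking field `K` — `C^∞` and Killing on an open
`U ⊇ 𝓔⁺`, `[T, K] = 0` on `U`, `K ≠ 0` on `𝓔⁺`, integral curves of `K` from `𝓔⁺` stay in `𝓔⁺`,
`K` timelike on `U ∩ ⟨⟨M_ext⟩⟩`, `∇_K K = κ K` on `𝓔⁺` with a constant `κ ≠ 0` —: EITHER `K = α T`
on `U'' ∩ ⟨⟨M_ext⟩⟩` for an open `U'' ⊇ 𝓔⁺` and a constant `α` (printed: "`T + λ₀ K ≡ 0` in `O'`"),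
OR there are an open `T`-invariant `V`, `𝓔⁺ ⊆ V ⊆ U`, constants `α`, `β ≠ 0`, a vector field `Z`,
smooth, Killing and `T`-commuting on `V` with `K = α T + β Z` on `V` (printed: "`Z = T + λ₀K` … which
commutes with `T`"), and a complete `2π`-periodic flow `Φ` of `Z` on `V` preserving `V ∩ ⟨⟨M_ext⟩⟩`
(printed: "`Ψ_{t₀,Z} = Id` in `O'`"; period normalised to `2π` by rescaling `Z`).  Translation of the
printed bifurcate statement as explained in the module docstring.
[cite: AlexakisIonescuKlainerman2010, Thm. 1.2, Prop. 5.2 and Lemma 5.3 (footnote)]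
[cite: RaczWald1996, Thm. 4.2] [cite: ChruscielCosta2008, Thm. 4.11 and Props. 4.1–4.3]
[cite: FriedrichRaczWald1999, Lemma 2.1 and Prop. 2.1] -/
def alexakisIonescuKlainerman2010_nearHorizonAxialKilling : Prop :=
  ∀ (𝓑 : StationaryAFBlackHole.{0}) [𝓑.metric.HasLeviCivita],
    𝓑.metric.toPseudoRiemannianMetric.IsRicciFlat → 𝓑.IsIPlusRegular →
    (∀ p : 𝓑.carrier, p ∈ 𝓑.metric.chronologicalFuture 𝓑.timeOrientation 𝓑.Mext) →
    IsConnected 𝓑.horizon →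
    ∀ (U : Set 𝓑.carrier) (K : Π x : 𝓑.carrier, TangentSpace (𝓡 4) x), IsOpen U → 𝓑.horizon ⊆ U →
      ContMDiffOn (𝓡 4) ((𝓡 4).prod 𝓘(ℝ, E4)) ((⊤ : ℕ∞) : WithTop ℕ∞)
        (fun x ↦ (TotalSpace.mk' E4 x (K x) : TangentBundle (𝓡 4) 𝓑.carrier)) U →
      (∀ x ∈ U, ∀ v w : TangentSpace (𝓡 4) x,
        𝓑.metric.val x (𝓑.metric.leviCivita K x v) w +
          𝓑.metric.val x v (𝓑.metric.leviCivita K x w) = 0) →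
      (∀ x ∈ U, VectorField.mlieBracket (𝓡 4) 𝓑.killing K x = 0) →
      (∀ p ∈ 𝓑.horizon, K p ≠ 0) →
      (∀ γ : ℝ → 𝓑.carrier, IsMIntegralCurve γ K → γ 0 ∈ 𝓑.horizon → ∀ t, γ t ∈ 𝓑.horizon) →
      (∀ x ∈ U ∩ 𝓑.doc, 𝓑.metric.val x (K x) (K x) < 0) →
      (∃ κ : ℝ, κ ≠ 0 ∧ ∀ p ∈ 𝓑.horizon, 𝓑.metric.leviCivita K p (K p) = κ • K p) →
      (∃ U'' : Set 𝓑.carrier, IsOpen U'' ∧ 𝓑.horizon ⊆ U'' ∧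
          ∃ α : ℝ, ∀ x ∈ U'' ∩ 𝓑.doc, K x = α • 𝓑.killing x) ∨
      ∃ (V : Set 𝓑.carrier) (Z : Π x : 𝓑.carrier, TangentSpace (𝓡 4) x)
        (Φ : ℝ → 𝓑.carrier → 𝓑.carrier) (α β : ℝ),
        IsOpen V ∧ 𝓑.horizon ⊆ V ∧ V ⊆ U ∧ β ≠ 0 ∧
        (∀ γ : ℝ → 𝓑.carrier, IsMIntegralCurve γ 𝓑.killing → γ 0 ∈ V → ∀ t, γ t ∈ V) ∧
        ContMDiffOn (𝓡 4) ((𝓡 4).prod 𝓘(ℝ, E4)) ((⊤ : ℕ∞) : WithTop ℕ∞)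
          (fun x ↦ (TotalSpace.mk' E4 x (Z x) : TangentBundle (𝓡 4) 𝓑.carrier)) V ∧
        (∀ x ∈ V, ∀ v w : TangentSpace (𝓡 4) x,
          𝓑.metric.val x (𝓑.metric.leviCivita Z x v) w +
            𝓑.metric.val x v (𝓑.metric.leviCivita Z x w) = 0) ∧
        (∀ x ∈ V, VectorField.mlieBracket (𝓡 4) 𝓑.killing Z x = 0) ∧
        (∀ x ∈ V, K x = α • 𝓑.killing x + β • Z x) ∧
        (∀ x ∈ V, Φ 0 x = x ∧ (∀ s : ℝ, Φ s x ∈ V) ∧ (∀ s : ℝ, Φ (s + 2 * Real.pi) x = Φ s x) ∧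
          IsMIntegralCurve (fun s ↦ Φ s x) Z) ∧
        (∀ x ∈ V ∩ 𝓑.doc, ∀ s : ℝ, Φ s x ∈ 𝓑.doc)

end Literature.Geometry.Lorentzian

end
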